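import Literature.Algebra.Homology.GroupCohomologyInnerAutomorphism
import Literature.Algebra.Homology.ShapiroExplicit
import HarnessLib

/-!
# Conjugation on coinduced modules and the Shapiro map

Topic `Algebra/Homology`; namespace `Literature.Algebra.Homology`.  the inner-automorphism lemma
(`GroupCohomologyInnerAutomorphism`) and the explicit Shapiro isomorphism (`ShapiroExplicit`).

Let `S ≤ G`, `A` a `k`-linear representation of `G` (restricted to `S` where needed) and `t ∈ G`
with `t⁻¹ S t ⊆ S`.  On the coinduced module `Coind_S^G(A) = {f : G → A | f(s g) = s f(g)}` the
map `(D_t f)(g) = t · f(t⁻¹ g)` is a `G`-endomorphism (`coindConj`; for `A` a module of functions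
this is the Hecke-type operator of `t`).  The **Shapiro map**
`Ψ = H•(S ↪ G, ev₁) : Hⁿ(G, Coind A) → Hⁿ(S, A)` (`map S.subtype coindEv`) intertwines `(D_t)_*`
with the pair map `Φ_t = Hⁿ(c_t, ρ(t))` of `(S, A)`, `c_t(s) = t⁻¹ s t`
(`map_coindConj_comp_shapiroMap`):

  `Hⁿ(𝟙, D_t) ≫ Ψ = Ψ ≫ Hⁿ(c_t, ρ(t))`.

Proof: both sides are `Hⁿ` of a morphism of pairs `(S, A) → (G, Coind A)` over `s ↦ t⁻¹ s t`;
they differ by the inner automorphism `(h ↦ t⁻¹ h t, ρ(t))` of `(G, Coind A)`, which acts as the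
identity (`map_conj_eq_id`). [cite: Brown1982CohomologyGroups, III (8.3) and §5–§6]

## References

* K. S. Brown, *Cohomology of Groups*, GTM 87 (1982), III §5–§6, (8.3). [Brown1982CohomologyGroups]
-/

noncomputable section

open CategoryTheory groupCohomology

namespace Literature.Algebra.Homology

universe u

variable {k G : Type u} [CommRing k] [Group G] (S : Subgroup G) (A : Rep.{u} k G)

/-! ### The objects -/

/-- `A` restricted to `S`. [folklore] -/
abbrev resSub : Rep k S := Rep.res S.subtype A

/-- `Coind_S^G(A|_S)`. [folklore] -/
abbrev coindSub : Rep k G := Rep.coind S.subtype (resSub S A)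

/-- Evaluation at `1`: `Coind_S^G(A)|_S ⟶ A|_S`, the counit of `res ⊣ coind`
(`Literature.Algebra.Homology.coindCounit` of `ShapiroExplicit`). [folklore] -/
abbrev coindEv : Rep.res S.subtype (coindSub S A) ⟶ resSub S A :=
  coindCounit S (resSub S A)

/-- Unfolding `coindEv`. [folklore] -/
theorem coindEv_hom_apply (f : coindSub S A) : (coindEv S A).hom f = f.1 1 := rfl

/-- **The Shapiro map `Ψ = Hⁿ(S ↪ G, ev₁)` is injective** (it is Mathlib's Shapiro isomorphism,
`ShapiroExplicit.coindIso_hom_eq`). [cite: Brown1982CohomologyGroups, III (6.2)] -/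
theorem shapiroMap_injective (n : ℕ) :
    Function.Injective (groupCohomology.map S.subtype (coindEv S A) n).hom :=
  map_subtype_coindCounit_injective S (resSub S A) n

variable (t : G) (ht : ∀ s ∈ S, t⁻¹ * s * t ∈ S)

/-- Conjugation `s ↦ t⁻¹ s t` on `S` (for `t⁻¹ S t ⊆ S`). [folklore] -/
def subgroupConj : S →* S where
  toFun s := ⟨t⁻¹ * s * t, ht s s.2⟩
  map_one' := Subtype.ext (by simp)
  map_mul' a b := Subtype.ext (by
    change t⁻¹ * (a * b : G) * t = t⁻¹ * a * t * (t⁻¹ * b * t)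
    group)

/-- Unfolding `subgroupConj`. [folklore] -/
@[simp]
theorem coe_subgroupConj_apply (s : S) : (subgroupConj S t ht s : G) = t⁻¹ * s * t := rfl

/-- The pair map `ρ(t) : A|_S ∘ c_t ⟶ A|_S`. [folklore] -/
def resConj : Rep.res (subgroupConj S t ht) (resSub S A) ⟶ resSub S A :=
  Rep.ofHom (LinearMap.intertwiningMap_of_isIntertwiningMap _ _ (A.ρ t) fun s a => by
    change A.ρ t (A.ρ ((subgroupConj S t ht s : S) : G) a) = A.ρ (s : G) (A.ρ t a)
    rw [← Module.End.mul_apply, ← map_mul, ← Module.End.mul_apply, ← map_mul, coe_subgroupConj_apply]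
    have hts : t * (t⁻¹ * (s : G) * t) = (s : G) * t := by group
    rw [hts])

/-- Unfolding `resConj`. [folklore] -/
@[simp]
theorem resConj_hom_apply (a : A) : (resConj S A t ht).hom a = A.ρ t a := rfl

/-- **The conjugation operator `D_t` on `Coind_S^G(A)`**: `(D_t f)(g) = t · f(t⁻¹ g)`. [folklore] -/
def coindConjLinear : coindSub S A →ₗ[k] coindSub S A where
  toFun f := ⟨fun g => A.ρ t (f.1 (t⁻¹ * g)), fun s g => by
    change A.ρ t (f.1 (t⁻¹ * ((s : G) * g))) = A.ρ (s : G) (A.ρ t (f.1 (t⁻¹ * g)))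
    have h := f.2 (subgroupConj S t ht s) (t⁻¹ * g)
    change f.1 (t⁻¹ * s * t * (t⁻¹ * g)) = A.ρ (t⁻¹ * s * t) (f.1 (t⁻¹ * g)) at h
    rw [show t⁻¹ * ((s : G) * g) = t⁻¹ * s * t * (t⁻¹ * g) by group, h, ← Module.End.mul_apply,
      ← map_mul, ← Module.End.mul_apply, ← map_mul]
    congr 2
    group⟩
  map_add' f f' := Subtype.ext (funext fun g => by
    change A.ρ t ((f.1 + f'.1) (t⁻¹ * g)) = A.ρ t (f.1 (t⁻¹ * g)) + A.ρ t (f'.1 (t⁻¹ * g))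
    rw [Pi.add_apply, map_add])
  map_smul' c f := Subtype.ext (funext fun g => by
    change A.ρ t ((c • f.1) (t⁻¹ * g)) = c • A.ρ t (f.1 (t⁻¹ * g))
    rw [Pi.smul_apply, map_smul])

/-- Unfolding `coindConjLinear`. [folklore] -/
@[simp]
theorem coindConjLinear_apply_coe (f : coindSub S A) (g : G) :
    (coindConjLinear S A t ht f).1 g = A.ρ t (f.1 (t⁻¹ * g)) := rfl

/-- `D_t` is `G`-equivariant (typed as a morphism of pairs over `𝟙 G`, the shape
`groupCohomology.map (MonoidHom.id G)` expects). [folklore] -/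
def coindConj : Rep.res (MonoidHom.id G) (coindSub S A) ⟶ coindSub S A :=
  Rep.ofHom (LinearMap.intertwiningMap_of_isIntertwiningMap _ _ (coindConjLinear S A t ht) fun g f => by
    refine Subtype.ext (funext fun x => ?_)
    change A.ρ t (f.1 (t⁻¹ * x * g)) = A.ρ t (f.1 (t⁻¹ * (x * g)))
    rw [mul_assoc])

/-- Unfolding `coindConj`. [folklore] -/
@[simp]
theorem coindConj_hom_apply_coe (f : coindSub S A) (g : G) :
    ((coindConj S A t ht).hom f).1 g = A.ρ t (f.1 (t⁻¹ * g)) := rfl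

/-! ### Congruence of `groupCohomology.map` -/

omit S A t ht in
/-- `Hⁿ(f, φ)` depends only on `f` and the underlying function of `φ`. [folklore] -/
theorem map_congr' {H : Type u} [Group H] {X : Rep k H} {Y : Rep k G} {f₁ f₂ : G →* H} (h : f₁ = f₂)
    (φ₁ : Rep.res f₁ X ⟶ Y) (φ₂ : Rep.res f₂ X ⟶ Y) (hφ : ∀ x : X, φ₁.hom x = φ₂.hom x) (n : ℕ) :
    groupCohomology.map f₁ φ₁ n = groupCohomology.map f₂ φ₂ n := by
  subst h
  have : φ₁ = φ₂ := Rep.hom_ext (Representation.IntertwiningMap.ext (LinearMap.ext hφ))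
  rw [this]

/-! ### The Shapiro map intertwines `D_t` with the pair map `(c_t, ρ(t))` -/

/-- **`Hⁿ(𝟙, D_t) ≫ Ψ = Ψ ≫ Hⁿ(c_t, ρ(t))`** for the Shapiro map `Ψ = Hⁿ(S ↪ G, ev₁)`.
[cite: Brown1982CohomologyGroups, III (8.3)] -/
theorem map_coindConj_comp_shapiroMap (n : ℕ) :
    groupCohomology.map (MonoidHom.id G) (coindConj S A t ht) n ≫
        groupCohomology.map S.subtype (coindEv S A) n =
      groupCohomology.map S.subtype (coindEv S A) n ≫
        groupCohomology.map (subgroupConj S t ht) (resConj S A t ht) n := by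
  have h1 := map_conj_eq_id (coindSub S A) t n
  have eL : groupCohomology.map (MonoidHom.id G) (coindConj S A t ht) n ≫
        groupCohomology.map S.subtype (coindEv S A) n =
      groupCohomology.map (((conjBy t).comp (MonoidHom.id G)).comp S.subtype)
        ((Rep.resFunctor S.subtype).map
          ((Rep.resFunctor (MonoidHom.id G)).map (conjRepHom (coindSub S A) t) ≫ coindConj S A t ht) ≫
          coindEv S A) n := by
    rw [groupCohomology.map_comp, groupCohomology.map_comp, h1, Category.id_comp]
  have eR : groupCohomology.map S.subtype (coindEv S A) n ≫
        groupCohomology.map (subgroupConj S t ht) (resConj S A t ht) n =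
      groupCohomology.map (S.subtype.comp (subgroupConj S t ht))
        ((Rep.resFunctor (subgroupConj S t ht)).map (coindEv S A) ≫ resConj S A t ht) n := by
    rw [groupCohomology.map_comp]
  rw [eL, eR]
  refine map_congr' ?_ _ _ (fun f => ?_) n
  · ext s
    simp [conjBy_apply, mul_assoc]
  · change A.ρ t (f.1 (t⁻¹ * 1 * t)) = A.ρ t (f.1 1)
    rw [mul_one, inv_mul_cancel]

/-- Element form of `map_coindConj_comp_shapiroMap`. [folklore] -/
theorem shapiroMap_coindConj_apply (n : ℕ) (x : groupCohomology (coindSub S A) n) :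
    (groupCohomology.map S.subtype (coindEv S A) n).hom
        ((groupCohomology.map (MonoidHom.id G) (coindConj S A t ht) n).hom x) =
      (groupCohomology.map (subgroupConj S t ht) (resConj S A t ht) n).hom
        ((groupCohomology.map S.subtype (coindEv S A) n).hom x) := by
  have h := map_coindConj_comp_shapiroMap S A t ht n
  have := congrArg (fun φ => φ.hom x) h
  simpa only [ModuleCat.hom_comp, LinearMap.comp_apply] using this

end Literature.Algebra.Homology
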